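import Summits.Ventures.Crystal3D.Theorems.StickyWulffConstantTextureBuildExposedFacets
import Summits.Ventures.Crystal3D.Theorems.StickyWulffConstantTextureBuildCoplanarFacets
import Summits.Ventures.Crystal3D.Theorems.StickyWulffConstantPolycrystalWulffBoundFacetAreaSymm
import HarnessLib

/-!
# TB-D assembly, part 7b′: LEDGER SPLITTING, FREE HALF, with ORIENTATION-FREE designated regions (repair B of TB-D-3)
# (lane T, crux `TextureLiminfV5`, stmt-Ventures-23912; TB-D-3-g20 §LP1 ★; companion of `free_le_split` p715179)

HONEST FRAMING. Venture `Summits/Ventures/Crystal3D` (cell `crystal3d-full`), route `route-Ventures-StickyWulffConstant`, helper `--supports` the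
law-v5 crux `TextureLiminfV5` (stmt-Ventures-23912).  Pure continuum bookkeeping (census-free, standard axioms); nothing about any cover or mesh; F-C1 not moved.

WHAT.  `free_le_split′` = `free_le_split` with the exposed-facet classification (P1′) allowed to place an exposed facet point in a designated planar region of
EITHER orientation (`(nrm d, lvl d) = p ∨ (−nrm d, −lvl d) = p`, as the wall half already does), with the SAME constant `κW` (not `2κW`): the exposed sets
`E μ p := (closure (P μ) ∩ plane p) ∖ ⋃_{μ′ ≠ μ} closure (P μ′)` of DIFFERENT pieces are pairwise DISJOINT outright, whatever their orientation, so their traces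
on one region `Φ d` add up (`sum_facetArea_le_of_disjoint` — additivity of the prism volume over disjoint planar sets, `prism_decomp_unique`), and
`facetArea F (−ν) = facetArea F ν` (`Theorems.facetArea_neg`, …PolycrystalWulffBoundFacetAreaSymm).  This closes the one configuration of TB-D-3 (a designated internal crack of a
territory along the free surface) on the energy side, with no new mesh clause.
-/

noncomputable section

namespace Summit.Ventures.Crystal3D.Cruxes.TextureLiminf.TexShadow

open Summit.Ventures.Crystal3D Summit.Ventures.Crystal3D.Theorems MeasureTheory Set
open scoped InnerProductSpace


/-! ### Prisms: differences, disjoint additivity -/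

/-- The prism over a difference of planar sets is the difference of the prisms. -/
theorem prism_diff_eq {n : E3} (hn : ‖n‖ = 1) {c₀ : ℝ} {A B : Set E3} (hA : A ⊆ {x : E3 | ⟪n, x⟫_ℝ = c₀}) (hB : B ⊆ {x : E3 | ⟪n, x⟫_ℝ = c₀}) :
    {x : E3 | ∃ y ∈ A \ B, ∃ t ∈ Set.Icc (0 : ℝ) 1, x = y + t • n} =
      {x : E3 | ∃ y ∈ A, ∃ t ∈ Set.Icc (0 : ℝ) 1, x = y + t • n} \ {x : E3 | ∃ y ∈ B, ∃ t ∈ Set.Icc (0 : ℝ) 1, x = y + t • n} := by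
  ext x
  simp only [mem_setOf_eq, mem_sdiff]
  constructor
  · rintro ⟨y, ⟨hyA, hyB⟩, t, ht, rfl⟩
    refine ⟨⟨y, hyA, t, ht, rfl⟩, ?_⟩
    rintro ⟨y', hy', t', ht', h⟩
    obtain ⟨rfl, -⟩ := prism_decomp_unique hn (hA hyA) (hB hy') h
    exact hyB hy'
  · rintro ⟨⟨y, hyA, t, ht, rfl⟩, hnot⟩
    exact ⟨y, ⟨hyA, fun hyB => hnot ⟨y, hyB, t, ht, rfl⟩⟩, t, ht, rfl⟩

/-- **Additivity of facet area over pairwise disjoint planar sets** inside a closed bounded planar region. -/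
theorem sum_facetArea_le_of_disjoint {κ : Type*} (s : Finset κ) (A : κ → Set E3) {n : E3} (hn : ‖n‖ = 1) {c₀ : ℝ}
    {R : Set E3} (hR : R ⊆ {x : E3 | ⟪n, x⟫_ℝ = c₀}) (hRb : Bornology.IsBounded R) (hAR : ∀ j ∈ s, A j ⊆ R)
    (hd : ∀ j ∈ s, ∀ j' ∈ s, j ≠ j' → Disjoint (A j) (A j'))
    (hm : ∀ j ∈ s, NullMeasurableSet {x : E3 | ∃ y ∈ A j, ∃ t ∈ Set.Icc (0 : ℝ) 1, x = y + t • n} volume) :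
    ∑ j ∈ s, facetArea (A j) n ≤ facetArea R n := by
  classical
  set T : κ → Set E3 := fun j => {x : E3 | ∃ y ∈ A j, ∃ t ∈ Set.Icc (0 : ℝ) 1, x = y + t • n} with hT
  set TR : Set E3 := {x : E3 | ∃ y ∈ R, ∃ t ∈ Set.Icc (0 : ℝ) 1, x = y + t • n} with hTR
  have hTsub : (⋃ j ∈ s, T j) ⊆ TR := by
    intro x hx
    obtain ⟨j, hj, y, hy, t, ht, rfl⟩ := mem_iUnion₂.1 hx
    exact ⟨y, hAR j hj hy, t, ht, rfl⟩
  have hTfin : ∀ j ∈ s, volume (T j) ≠ ⊤ := fun j hj =>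
    volume_prism_ne_top_of_isBounded hRb _ (fun y hy => subset_closure (hAR j hj hy)) n
  have hdisjT : ∀ j ∈ s, ∀ j' ∈ s, j ≠ j' → Disjoint (T j) (T j') := by
    intro j hj j' hj' hne
    rw [Set.disjoint_left]
    rintro x ⟨y, hy, t, ht, rfl⟩ ⟨y', hy', t', ht', h⟩
    obtain ⟨rfl, -⟩ := prism_decomp_unique hn (hR (hAR j hj hy)) (hR (hAR j' hj' hy')) h
    exact Set.disjoint_left.1 (hd j hj j' hj' hne) hy hy'
  have hadd : volume (⋃ j ∈ s, T j) = ∑ j ∈ s, volume (T j) :=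
    measure_biUnion_finset₀ (fun j hj j' hj' hne => (hdisjT j hj j' hj' hne).aedisjoint) (fun j hj => hm j hj)
  change ∑ j ∈ s, (volume (T j)).toReal ≤ (volume TR).toReal
  rw [← ENNReal.toReal_sum (fun j hj => hTfin j hj), ← hadd]
  exact ENNReal.toReal_mono (volume_prism_ne_top_of_isBounded hRb R subset_closure n) (measure_mono hTsub)

/-- Pieces carrying both an oriented datum and its antipode are empty. -/
theorem polytope_eq_empty_of_mem_antip {H : Finset (E3 × ℝ)} {p : E3 × ℝ} (hp : p ∈ H) (hp' : (-p.1, -p.2) ∈ H) : polytope H = ∅ := by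
  rw [Set.eq_empty_iff_forall_notMem]
  intro x hx
  simp only [polytope, mem_iInter, mem_setOf_eq] at hx
  have h1 := hx p hp
  have h2 := hx _ hp'
  simp only [inner_neg_left] at h2
  linarith

/-! ### The free half with orientation-free designated regions -/

/-- **LEDGER SPLITTING, FREE HALF, orientation-free designated regions** (`free_le_split` with (P1′)). -/
theorem free_le_split' {n M : ℕ} (K : Fin n → Set E3) (hKc : ∀ ℓ, IsCompact (K ℓ)) (hKv : ∀ ℓ, Convex ℝ (K ℓ))
    (hK0 : ∀ ℓ, (0 : E3) ∈ K ℓ) {κW : ℝ} (hκW : 0 ≤ κW) (hKW : ∀ ℓ (ν : E3), ‖ν‖ = 1 → supportFn (K ℓ) ν ≤ κW)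
    (Hp : Fin M → Finset (E3 × ℝ)) (cls : Fin M → Fin n)
    (hbd : ∀ μ, Bornology.IsBounded (polytope (Hp μ)))
    (hunit : ∀ μ, ∀ p ∈ Hp μ, ‖p.1‖ = 1)
    (hplanes : ∀ μ, ∀ p ∈ Hp μ, ∀ p' ∈ Hp μ, p ≠ p' →
      {x : E3 | ⟪p.1, x⟫_ℝ = p.2} ≠ {x : E3 | ⟪p'.1, x⟫_ℝ = p'.2})
    (hdisj : ∀ μ μ', μ ≠ μ' → Disjoint (polytope (Hp μ)) (polytope (Hp μ')))
    {ι : Type*} (dS : Finset ι) (Φ : ι → Set E3) (nrm : ι → E3) (lvl : ι → ℝ)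
    (hΦ : ∀ d ∈ dS, Φ d ⊆ {x : E3 | ⟪nrm d, x⟫_ℝ = lvl d}) (hnrm : ∀ d ∈ dS, ‖nrm d‖ = 1)
    (hΦc : ∀ d ∈ dS, IsClosed (Φ d)) (hΦb : ∀ d ∈ dS, Bornology.IsBounded (Φ d))
    (V : Fin n → Set E3) (hV : ∀ ℓ, IsOpen (V ℓ))
    (hVfin : ∀ ℓ, perKIn (K ℓ) (⋃ μ, polytope (Hp μ)) (V ℓ) ≠ ⊤)
    (hP1 : ∀ μ, ∀ p ∈ Hp μ,
      facetArea (((closure (polytope (Hp μ)) ∩ {x : E3 | ⟪p.1, x⟫_ℝ = p.2}) \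
          ⋃ μ' ∈ Finset.univ.erase μ, closure (polytope (Hp μ'))) \
        (V (cls μ) ∪ ⋃ d ∈ dS.filter (fun d => (nrm d = p.1 ∧ lvl d = p.2) ∨ (-nrm d = p.1 ∧ -lvl d = p.2)), Φ d)) p.1 = 0) :
    (∑ μ, ∑ p ∈ Hp μ, supportFn (K (cls μ)) p.1 *
        facetArea ((closure (polytope (Hp μ)) ∩ {x : E3 | ⟪p.1, x⟫_ℝ = p.2}) \
          ⋃ μ' ∈ Finset.univ.erase μ, closure (polytope (Hp μ'))) p.1) ≤
      (∑ ℓ, (perKIn (K ℓ) (⋃ μ, polytope (Hp μ)) (V ℓ)).toReal) + κW * ∑ d ∈ dS, facetArea (Φ d) (nrm d) := by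
  classical
  -- names for the exposed sets and the orientation-free filter
  set E : Fin M → (E3 × ℝ) → Set E3 := fun μ p =>
    ((closure (polytope (Hp μ)) ∩ {x : E3 | ⟪p.1, x⟫_ℝ = p.2}) \ ⋃ μ' ∈ Finset.univ.erase μ, closure (polytope (Hp μ'))) with hE
  set mt : (E3 × ℝ) → ι → Prop := fun p d => (nrm d = p.1 ∧ lvl d = p.2) ∨ (-nrm d = p.1 ∧ -lvl d = p.2) with hmt
  have hEsub : ∀ μ p, E μ p ⊆ closure (polytope (Hp μ)) := fun μ p x hx => hx.1.1
  have hEpl : ∀ μ p, E μ p ⊆ {x : E3 | ⟪p.1, x⟫_ℝ = p.2} := fun μ p x hx => hx.1.2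
  -- exposed sets of different pieces are disjoint
  have hEdisj : ∀ μ μ' p p', μ ≠ μ' → Disjoint (E μ p) (E μ' p') := by
    intro μ μ' p p' hne
    rw [Set.disjoint_left]
    intro x hx hx'
    exact hx.2 (mem_iUnion₂.2 ⟨μ', Finset.mem_erase.2 ⟨hne.symm, Finset.mem_univ _⟩, hEsub μ' p' hx'⟩)
  have hsupp0 : ∀ ℓ (ν : E3), 0 ≤ supportFn (K ℓ) ν := by
    intro ℓ ν
    unfold supportFn
    have hb : BddAbove ((fun y : E3 => ⟪y, ν⟫_ℝ) '' K ℓ) := ((hKc ℓ).image (continuous_id.inner continuous_const)).bddAbove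
    simpa using le_csSup hb ⟨0, hK0 ℓ, by simp⟩
  have hh0 : ∀ μ (p : E3 × ℝ), 0 ≤ supportFn (K (cls μ)) p.1 := fun μ p => hsupp0 _ _
  have hfa0 : ∀ (S : Set E3) (ν : E3), 0 ≤ facetArea S ν := fun _ _ => ENNReal.toReal_nonneg
  -- STEP 1: per facet, the finite cover (traces of the EXPOSED set on the matching regions)
  have hstep1 : ∀ μ, ∀ p ∈ Hp μ, facetArea (E μ p) p.1 ≤
      facetArea (E μ p ∩ V (cls μ)) p.1 + ∑ d ∈ dS.filter (mt p), facetArea (E μ p ∩ Φ d) p.1 := by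
    intro μ p hp
    set Dp := dS.filter (mt p) with hDp
    set G : Option ι → Set E3 := fun o => match o with
      | none => (E μ p ∩ V (cls μ)) ∪ (E μ p \ (V (cls μ) ∪ ⋃ d ∈ Dp, Φ d))
      | some d => E μ p ∩ Φ d with hG
    have hcover : E μ p ⊆ ⋃ o ∈ insert none (Dp.image some), G o := by
      intro x hx
      by_cases hxV : x ∈ V (cls μ)
      · exact mem_iUnion₂.2 ⟨none, Finset.mem_insert_self _ _, Or.inl ⟨hx, hxV⟩⟩
      by_cases hxD : x ∈ ⋃ d ∈ Dp, Φ d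
      · obtain ⟨d, hd, hxd⟩ := mem_iUnion₂.1 hxD
        exact mem_iUnion₂.2 ⟨some d, Finset.mem_insert_of_mem (Finset.mem_image_of_mem _ hd), hx, hxd⟩
      · exact mem_iUnion₂.2 ⟨none, Finset.mem_insert_self _ _, Or.inr ⟨hx, fun h => h.elim hxV hxD⟩⟩
    have hfin : ∀ o ∈ insert none (Dp.image some), volume {x : E3 | ∃ y ∈ G o, ∃ t ∈ Set.Icc (0 : ℝ) 1, x = y + t • p.1} ≠ ⊤ := by
      intro o _
      rcases o with _ | d
      · refine volume_prism_ne_top_of_isBounded (hbd μ) _ (fun x hx => ?_) p.1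
        rcases hx with hx | hx
        · exact hEsub μ p hx.1
        · exact hEsub μ p hx.1
      · exact volume_prism_ne_top_of_isBounded (hbd μ) _ (fun x hx => hEsub μ p hx.1) p.1
    have h1 := facetArea_le_sum_of_subset_iUnion (insert none (Dp.image some)) (E μ p) G p.1 hcover hfin
    have hnotmem : none ∉ Dp.image some := by simp
    rw [Finset.sum_insert hnotmem, Finset.sum_image (fun d _ d' _ h => Option.some_injective _ h)] at h1
    have hnone : facetArea (G none) p.1 ≤ facetArea (E μ p ∩ V (cls μ)) p.1 + 0 := by
      have h2 := facetArea_le_sum_of_subset_iUnion (Finset.univ : Finset Bool) (G none)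
        (fun b => cond b (E μ p ∩ V (cls μ)) (E μ p \ (V (cls μ) ∪ ⋃ d ∈ Dp, Φ d))) p.1 ?_ ?_
      · have hrest : facetArea (E μ p \ (V (cls μ) ∪ ⋃ d ∈ Dp, Φ d)) p.1 = 0 := hP1 μ p hp
        simpa [Fintype.sum_bool, hrest] using h2
      · intro x hx
        rcases hx with hx | hx
        · exact mem_iUnion₂.2 ⟨true, Finset.mem_univ _, hx⟩
        · exact mem_iUnion₂.2 ⟨false, Finset.mem_univ _, hx⟩
      · intro b _
        cases b
        · exact volume_prism_ne_top_of_isBounded (hbd μ) _ (fun x hx => hEsub μ p hx.1) p.1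
        · exact volume_prism_ne_top_of_isBounded (hbd μ) _ (fun x hx => hEsub μ p hx.1) p.1
    have hsome : ∑ d ∈ Dp, facetArea (G (some d)) p.1 = ∑ d ∈ Dp, facetArea (E μ p ∩ Φ d) p.1 := rfl
    linarith
  -- STEP 2: multiply by the weights and sum
  have hstep2 : (∑ μ, ∑ p ∈ Hp μ, supportFn (K (cls μ)) p.1 * facetArea (E μ p) p.1) ≤
      (∑ μ, ∑ p ∈ Hp μ, supportFn (K (cls μ)) p.1 * facetArea (E μ p ∩ V (cls μ)) p.1) +
      ∑ μ, ∑ p ∈ Hp μ, supportFn (K (cls μ)) p.1 * ∑ d ∈ dS.filter (mt p), facetArea (E μ p ∩ Φ d) p.1 := by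
    rw [← Finset.sum_add_distrib]
    refine Finset.sum_le_sum fun μ _ => ?_
    rw [← Finset.sum_add_distrib]
    refine Finset.sum_le_sum fun p hp => ?_
    rw [← mul_add]
    exact mul_le_mul_of_nonneg_left (hstep1 μ p hp) (hh0 μ p)
  -- STEP 3: the tent part, class by class, via `exposedFacetSumIn_le_perKIn`
  have hstep3 : (∑ μ, ∑ p ∈ Hp μ, supportFn (K (cls μ)) p.1 * facetArea (E μ p ∩ V (cls μ)) p.1) ≤
      ∑ ℓ, (perKIn (K ℓ) (⋃ μ, polytope (Hp μ)) (V ℓ)).toReal := by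
    rw [← Finset.sum_fiberwise Finset.univ cls
      (fun μ => ∑ p ∈ Hp μ, supportFn (K (cls μ)) p.1 * facetArea (E μ p ∩ V (cls μ)) p.1)]
    refine Finset.sum_le_sum fun ℓ _ => ?_
    have hall : (∑ μ ∈ Finset.univ.filter (fun μ => cls μ = ℓ), ∑ p ∈ Hp μ, supportFn (K (cls μ)) p.1 * facetArea (E μ p ∩ V (cls μ)) p.1) ≤
        ∑ μ, ∑ p ∈ Hp μ, supportFn (K ℓ) p.1 * facetArea (E μ p ∩ V ℓ) p.1 := by
      calc (∑ μ ∈ Finset.univ.filter (fun μ => cls μ = ℓ), ∑ p ∈ Hp μ, supportFn (K (cls μ)) p.1 * facetArea (E μ p ∩ V (cls μ)) p.1)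
          = ∑ μ ∈ Finset.univ.filter (fun μ => cls μ = ℓ), ∑ p ∈ Hp μ, supportFn (K ℓ) p.1 * facetArea (E μ p ∩ V ℓ) p.1 :=
            Finset.sum_congr rfl fun μ hμ => by rw [(Finset.mem_filter.1 hμ).2]
        _ ≤ ∑ μ, ∑ p ∈ Hp μ, supportFn (K ℓ) p.1 * facetArea (E μ p ∩ V ℓ) p.1 :=
            Finset.sum_le_sum_of_subset_of_nonneg (Finset.filter_subset _ _) fun μ _ _ =>
              Finset.sum_nonneg fun p _ => mul_nonneg (hsupp0 _ _) (hfa0 _ _)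
    refine hall.trans ?_
    have hex := exposedFacetSumIn_le_perKIn Hp hbd hunit hplanes hdisj (hV ℓ) (hKc ℓ) (hKv ℓ) (hK0 ℓ)
    exact (ENNReal.ofReal_le_iff_le_toReal (hVfin ℓ)).1 hex
  -- STEP 4′: the designated part — re-indexed by `d`, orientation absorbed by `facetArea_neg`, traces of DISJOINT exposed sets add up
  have hstep4 : (∑ μ, ∑ p ∈ Hp μ, supportFn (K (cls μ)) p.1 * ∑ d ∈ dS.filter (mt p), facetArea (E μ p ∩ Φ d) p.1) ≤
      κW * ∑ d ∈ dS, facetArea (Φ d) (nrm d) := by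
    -- weights ≤ κW and orientation
    have hw : (∑ μ, ∑ p ∈ Hp μ, supportFn (K (cls μ)) p.1 * ∑ d ∈ dS.filter (mt p), facetArea (E μ p ∩ Φ d) p.1) ≤
        ∑ μ, ∑ p ∈ Hp μ, κW * ∑ d ∈ dS.filter (mt p), facetArea (E μ p ∩ Φ d) (nrm d) := by
      refine Finset.sum_le_sum fun μ _ => Finset.sum_le_sum fun p hp => ?_
      have hor : ∑ d ∈ dS.filter (mt p), facetArea (E μ p ∩ Φ d) p.1 = ∑ d ∈ dS.filter (mt p), facetArea (E μ p ∩ Φ d) (nrm d) := by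
        refine Finset.sum_congr rfl fun d hd => ?_
        rcases (Finset.mem_filter.1 hd).2 with ⟨h1, -⟩ | ⟨h1, -⟩
        · rw [h1]
        · rw [← h1, facetArea_neg]
      rw [hor]
      exact mul_le_mul_of_nonneg_right (hKW _ _ (hunit μ p hp)) (Finset.sum_nonneg fun d _ => hfa0 _ _)
    refine hw.trans ?_
    -- swap the sums: Σ_μ Σ_p κW Σ_{d : mt p d} = κW Σ_d Σ_μ Σ_{p : mt p d}
    have hswap : ∀ μ, (∑ p ∈ Hp μ, κW * ∑ d ∈ dS.filter (mt p), facetArea (E μ p ∩ Φ d) (nrm d)) =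
        κW * ∑ d ∈ dS, ∑ p ∈ (Hp μ).filter (fun p => mt p d), facetArea (E μ p ∩ Φ d) (nrm d) := by
      intro μ
      rw [← Finset.mul_sum]
      congr 1
      rw [Finset.sum_comm' (t' := dS) (s' := fun d => (Hp μ).filter (fun p => mt p d))]
      intro p d
      simp only [Finset.mem_filter]
      tauto
    simp only [hswap]
    rw [← Finset.mul_sum, Finset.sum_comm]
    refine mul_le_mul_of_nonneg_left (Finset.sum_le_sum fun d hd => ?_) hκW
    -- for ONE region `Φ d`: the traces of the exposed sets of all (piece, matching datum) pairs are pairwise disjoint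
    rw [← Finset.sum_sigma (Finset.univ : Finset (Fin M)) (fun μ => (Hp μ).filter (fun p => mt p d))
      (fun x => facetArea (E x.1 x.2 ∩ Φ d) (nrm d))]
    refine sum_facetArea_le_of_disjoint (Finset.univ.sigma fun μ => (Hp μ).filter (fun p => mt p d))
      (fun x : (Σ _ : Fin M, E3 × ℝ) => E x.1 x.2 ∩ Φ d) (hnrm d hd) (R := Φ d) (hΦ d hd) (hΦb d hd)
      (fun x _ => inter_subset_right) ?_ ?_
    · -- disjointness
      rintro ⟨μ, p⟩ hx ⟨μ', p'⟩ hx' hne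
      by_cases hμ : μ = μ'
      · subst hμ
        have hpp : p ≠ p' := fun h => hne (by subst h; rfl)
        have hp := (Finset.mem_filter.1 (Finset.mem_sigma.1 hx).2)
        have hp' := (Finset.mem_filter.1 (Finset.mem_sigma.1 hx').2)
        -- both data are `±(nrm d, lvl d)` and differ: the piece carries a datum and its antipode, so it is empty
        have hempty : polytope (Hp μ) = ∅ := by
          rcases hp.2 with ⟨h1, h2⟩ | ⟨h1, h2⟩ <;> rcases hp'.2 with ⟨h1', h2'⟩ | ⟨h1', h2'⟩
          · exact absurd (Prod.ext (h1.symm.trans h1') (h2.symm.trans h2')) hpp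
          · refine polytope_eq_empty_of_mem_antip hp.1 ?_
            have : p' = (-p.1, -p.2) := Prod.ext (by rw [← h1', ← h1]) (by rw [← h2', ← h2])
            rw [← this]; exact hp'.1
          · refine polytope_eq_empty_of_mem_antip hp'.1 ?_
            have : p = (-p'.1, -p'.2) := Prod.ext (by rw [← h1, ← h1']) (by rw [← h2, ← h2'])
            rw [← this]; exact hp.1
          · exact absurd (Prod.ext (h1.symm.trans h1') (h2.symm.trans h2')) hpp
        rw [Set.disjoint_left]
        intro x hxE _
        have : x ∈ closure (polytope (Hp μ)) := hEsub μ p hxE.1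
        rw [hempty, closure_empty] at this
        exact this
      · exact (hEdisj μ μ' p p' hμ).mono inter_subset_left inter_subset_left
    · -- measurability of the prisms: `E μ p ∩ Φ d = A ∖ B` with `A`, `B` compact planar
      rintro ⟨μ, p⟩ hx
      have hp := (Finset.mem_filter.1 (Finset.mem_sigma.1 hx).2)
      set A : Set E3 := closure (polytope (Hp μ)) ∩ {x : E3 | ⟪p.1, x⟫_ℝ = p.2} ∩ Φ d with hA
      set B : Set E3 := (⋃ μ' ∈ Finset.univ.erase μ, closure (polytope (Hp μ'))) ∩ {x : E3 | ⟪nrm d, x⟫_ℝ = lvl d} with hB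
      have hAB : E μ p ∩ Φ d = A \ B := by
        ext x
        simp only [hE, hA, hB, mem_inter_iff, mem_sdiff]
        constructor
        · rintro ⟨⟨⟨hxc, hxp⟩, hxn⟩, hxΦ⟩
          exact ⟨⟨⟨hxc, hxp⟩, hxΦ⟩, fun h => hxn h.1⟩
        · rintro ⟨⟨⟨hxc, hxp⟩, hxΦ⟩, hxn⟩
          exact ⟨⟨⟨hxc, hxp⟩, fun h => hxn ⟨h, hΦ d hd hxΦ⟩⟩, hxΦ⟩
      have hApl : A ⊆ {x : E3 | ⟪nrm d, x⟫_ℝ = lvl d} := fun x hx => hΦ d hd hx.2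
      have hBpl : B ⊆ {x : E3 | ⟪nrm d, x⟫_ℝ = lvl d} := fun x hx => hx.2
      have hplc : IsClosed {x : E3 | ⟪nrm d, x⟫_ℝ = lvl d} := isClosed_eq (continuous_const.inner continuous_id) continuous_const
      have hAc : IsCompact A := Metric.isCompact_of_isClosed_isBounded
        ((isClosed_closure.inter (isClosed_eq (continuous_const.inner continuous_id) continuous_const)).inter (hΦc d hd))
        ((hbd μ).closure.subset (inter_subset_left.trans inter_subset_left))
      have hBc : IsCompact B := Metric.isCompact_of_isClosed_isBounded
        ((isClosed_biUnion_finset fun μ' _ => isClosed_closure).inter hplc)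
        (((Bornology.isBounded_biUnion_finset _).2 fun μ' _ => (hbd μ').closure).subset inter_subset_left)
      rw [hAB, prism_diff_eq (hnrm d hd) hApl hBpl]
      exact ((isCompact_prism hAc _).isClosed.measurableSet.diff (isCompact_prism hBc _).isClosed.measurableSet).nullMeasurableSet
  linarith [hstep2, hstep3, hstep4]

end Summit.Ventures.Crystal3D.Cruxes.TextureLiminf.TexShadow

end
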